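import Literature.NumberTheory.QuadraticFields.RealQuadraticClassNumber1365
import Literature.NumberTheory.QuadraticFields.RealQuadraticClassNumberOneInert
import Literature.NumberTheory.QuadraticFields.QuadraticDedekindZeta
import Mathlib.NumberTheory.NumberField.InfinitePlace.TotallyRealComplex
import HarnessLib

/-!
# The imaginary quadratic field `ℚ(√Δ)` for `Δ ≡ 5 (mod 8)`, `Δ < 0`

Route `ResidualThetaTransportAtTwo`, crux K0⁺ `HeckeThetaPartnerAdicAtTwo` (stmt-BirchSwinnertonDyer-20690),
helper §C1 of the line "proof from print".  THEOREMS ONLY (no definition, no named fact, no `sorry`).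

`exists_imaginaryQuadraticField`: for an integer `Δ < 0` with `Δ ≡ 5 (mod 8)` there is an imaginary
quadratic number field `k` (`[k:ℚ] = 2`, totally complex, Galois over `ℚ`) with `d_k ∣ Δ`, `d_k ≡ 5 (mod 8)`, an
algebraic integer `δ` with `δ² = Δ`, in which `2` is inert (`(2)` is a prime ideal) and which has no
ideal of norm `2`.  Construction: `|Δ| = b² a` with `a` squarefree (`Nat.sq_mul_squarefree_of_pos`);
`b` is odd, so `D = -a ≡ 5 (mod 8)` is a fundamental discriminant and `k = ℚ(√D)`
(`exists_numberField_discr_eq`); `δ = b · δ_k` with `δ_k² = d_k` (`exists_sq_eq_discr`); `2` inert and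
no ideal of norm `2` from `d_k ≡ 5 (mod 8)` (`eq_span_natCast_of_inert`, `no_root_two_of_emod_eight`,
`absNorm_ne_two_of_emod_eight`); signature from `d_k < 0`
(`nrRealPlaces_eq_zero_and_nrComplexPlaces_eq_one`).
-/

set_option autoImplicit false
set_option linter.dupNamespace false

noncomputable section

open scoped NumberField
open NumberField Module
open Literature.NumberTheory.QuadraticFields.Quadratic

namespace Summit.BirchSwinnertonDyer.BirchSwinnertonDyer.Theorems.HeckeThetaPartner

/-- **The imaginary quadratic field of an integer `Δ ≡ 5 (mod 8)`, `Δ < 0`.**  There is a number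
field `k` with `[k:ℚ] = 2`, totally complex, Galois over `ℚ`, `d_k ∣ Δ`, `d_k ≡ 5 (mod 8)`, an algebraic integer `δ`
with `δ² = Δ`, `(2)` a prime ideal of `𝓞 k`, and no ideal of `𝓞 k` of norm `2`. [folklore] -/
theorem exists_imaginaryQuadraticField {Δ : ℤ} (hΔ : Δ < 0) (hΔ8 : Δ % 8 = 5) :
    ∃ (k : Type) (_ : Field k) (_ : NumberField k), finrank ℚ k = 2 ∧ IsTotallyComplex k ∧
      IsGalois ℚ k ∧ discr k ∣ Δ ∧ discr k % 8 = 5 ∧ (∃ δ : 𝓞 k, δ ^ 2 = (Δ : 𝓞 k)) ∧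
      (Ideal.span {((2 : ℕ) : 𝓞 k)}).IsPrime ∧ ∀ I : Ideal (𝓞 k), Ideal.absNorm I ≠ 2 := by
  obtain ⟨a, b, ha, -, hab, hsq⟩ := Nat.sq_mul_squarefree_of_pos (Int.natAbs_pos.mpr hΔ.ne)
  -- `Δ = -(b² a)`, `b` odd, `D := -a ≡ 5 (mod 8)`
  have hΔab : Δ = -(((b : ℤ)) ^ 2 * (a : ℤ)) := by
    have h1 : (Δ.natAbs : ℤ) = -Δ := by omega
    have h2 : ((b ^ 2 * a : ℕ) : ℤ) = (Δ.natAbs : ℤ) := by rw [hab]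
    rw [h1] at h2
    push_cast at h2
    linarith
  have hbodd : (b : ℤ) % 2 = 1 := by
    rcases Int.emod_two_eq_zero_or_one (b : ℤ) with h | h
    · exfalso
      obtain ⟨c, hc⟩ : ∃ c, (b : ℤ) = 2 * c := ⟨(b : ℤ) / 2, by omega⟩
      have : Δ = -(4 * (c ^ 2 * a)) := by rw [hΔab, hc]; ring
      omega
    · exact h
  have hb8 : ((b : ℤ)) ^ 2 % 8 = 1 := by
    obtain ⟨s, hs⟩ : ∃ s, (b : ℤ) = 2 * s + 1 := ⟨(b : ℤ) / 2, by omega⟩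
    obtain ⟨e, he⟩ := Int.even_mul_succ_self s
    have hs' : (2 * s + 1) ^ 2 = 4 * (s * (s + 1)) + 1 := by ring
    rw [hs, hs', he]
    omega
  set D : ℤ := -(a : ℤ) with hDdef
  have hΔD : Δ = D * (b : ℤ) ^ 2 := by rw [hΔab, hDdef]; ring
  have hD8 : D % 8 = 5 := by
    have h1 : Δ % 8 = (D % 8) * ((b : ℤ) ^ 2 % 8) % 8 := by rw [hΔD, Int.mul_emod]
    rw [hb8, mul_one, Int.emod_emod_of_dvd _ (dvd_refl _)] at h1
    omega
  have hDneg : D < 0 := by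
    have : (0 : ℤ) < a := by exact_mod_cast ha
    rw [hDdef]; linarith
  have hDfund : (D % 4 = 1 ∧ Squarefree D ∧ D ≠ 1) ∨
      (4 ∣ D ∧ (D / 4 % 4 = 2 ∨ D / 4 % 4 = 3) ∧ Squarefree (D / 4)) := by
    refine Or.inl ⟨by omega, ?_, by omega⟩
    rw [← Int.squarefree_natAbs]
    simpa [hDdef] using hsq
  -- the field
  obtain ⟨k, _, _, hk, hdk⟩ := exists_numberField_discr_eq hDfund
  have hdneg : discr k < 0 := by rw [hdk]; exact hDneg
  haveI : IsTotallyComplex k :=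
    NumberField.nrRealPlaces_eq_zero_iff.mp (nrRealPlaces_eq_zero_and_nrComplexPlaces_eq_one hk hdneg).1
  -- an integral basis `(1, ω)`, `ω² = m + t ω`, `d_k = t² + 4m ≡ 5 (mod 8)`
  obtain ⟨bs, hbs⟩ := exists_basis_zero_eq_one hk
  have hω := basis_one_mul_self_eq bs hbs
  set m : ℤ := bs.repr (bs 1 * bs 1) 0 with hm
  set t : ℤ := bs.repr (bs 1 * bs 1) 1 with ht
  have hd8 : (t ^ 2 + 4 * m) % 8 = 5 := by
    rw [ht, hm, ← discr_eq_sq_add_four_mul bs hbs, hdk]; exact hD8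
  -- no root of `X² - tX - m` mod `2`
  have hno : ∀ x C : ℤ, ((2 : ℕ) : ℤ) * C ≠ x ^ 2 - t * x - m := by
    intro x C h
    apply no_root_two_of_emod_eight hd8 (x : ZMod 2)
    have h' := congrArg (Int.cast : ℤ → ZMod 2) h
    push_cast at h'
    rw [show (2 : ZMod 2) = 0 from rfl, zero_mul] at h'
    push_cast
    linear_combination -h'
  haveI : Algebra.IsQuadraticExtension ℚ k := { finrank_eq_two' := hk }
  refine ⟨k, inferInstance, inferInstance, hk, inferInstance, inferInstance, ⟨(b : ℤ) ^ 2, by rw [hdk, hΔD]⟩,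
    by rw [hdk]; exact hD8, ?_, ?_, fun I => absNorm_ne_two_of_emod_eight bs hbs hω hd8 I⟩
  · -- `δ = b δ_k`
    obtain ⟨-, -, δ₀, -, hδ₀⟩ := exists_sq_eq_discr hk
    refine ⟨(b : ℤ) * δ₀, ?_⟩
    rw [mul_pow, hδ₀, hdk, hΔD]
    push_cast
    ring
  · -- `(2)` is prime: it is the maximal ideal above `2`
    have hne : Ideal.span {((2 : ℕ) : 𝓞 k)} ≠ ⊤ := by
      rw [Ne, Ideal.span_singleton_eq_top]
      intro hu
      have := isUnit_of_isUnit_intCast (K := k) (g := 2) (by exact_mod_cast hu)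
      rcases Int.isUnit_iff.mp this with h | h <;> omega
    obtain ⟨Q, hQmax, hle⟩ := Ideal.exists_le_maximal _ hne
    have h2Q : ((2 : ℕ) : 𝓞 k) ∈ Q := hle (Ideal.mem_span_singleton_self _)
    have hQ := eq_span_natCast_of_inert bs hbs hω Nat.prime_two hno hQmax h2Q
    rw [← hQ]
    exact hQmax.isPrime

/-- **The imaginary quadratic field of an integer `Δ ≡ 5 (mod 8)`, `Δ < 0` — with `Δ = d_k m²`.**
Same as `exists_imaginaryQuadraticField`, recording moreover that `Δ / d_k` is the square of an integer
(`Δ = D b²` in the construction).  There is a number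
field `k` with `[k:ℚ] = 2`, totally complex, Galois over `ℚ`, `d_k ∣ Δ`, `d_k ≡ 5 (mod 8)`, an algebraic integer `δ`
with `δ² = Δ`, `(2)` a prime ideal of `𝓞 k`, and no ideal of `𝓞 k` of norm `2`. [folklore] -/
theorem exists_imaginaryQuadraticField_sq {Δ : ℤ} (hΔ : Δ < 0) (hΔ8 : Δ % 8 = 5) :
    ∃ (k : Type) (_ : Field k) (_ : NumberField k), finrank ℚ k = 2 ∧ IsTotallyComplex k ∧
      IsGalois ℚ k ∧ (∃ m : ℤ, Δ = discr k * m ^ 2) ∧ discr k % 8 = 5 ∧ (∃ δ : 𝓞 k, δ ^ 2 = (Δ : 𝓞 k)) ∧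
      (Ideal.span {((2 : ℕ) : 𝓞 k)}).IsPrime ∧ ∀ I : Ideal (𝓞 k), Ideal.absNorm I ≠ 2 := by
  obtain ⟨a, b, ha, -, hab, hsq⟩ := Nat.sq_mul_squarefree_of_pos (Int.natAbs_pos.mpr hΔ.ne)
  -- `Δ = -(b² a)`, `b` odd, `D := -a ≡ 5 (mod 8)`
  have hΔab : Δ = -(((b : ℤ)) ^ 2 * (a : ℤ)) := by
    have h1 : (Δ.natAbs : ℤ) = -Δ := by omega
    have h2 : ((b ^ 2 * a : ℕ) : ℤ) = (Δ.natAbs : ℤ) := by rw [hab]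
    rw [h1] at h2
    push_cast at h2
    linarith
  have hbodd : (b : ℤ) % 2 = 1 := by
    rcases Int.emod_two_eq_zero_or_one (b : ℤ) with h | h
    · exfalso
      obtain ⟨c, hc⟩ : ∃ c, (b : ℤ) = 2 * c := ⟨(b : ℤ) / 2, by omega⟩
      have : Δ = -(4 * (c ^ 2 * a)) := by rw [hΔab, hc]; ring
      omega
    · exact h
  have hb8 : ((b : ℤ)) ^ 2 % 8 = 1 := by
    obtain ⟨s, hs⟩ : ∃ s, (b : ℤ) = 2 * s + 1 := ⟨(b : ℤ) / 2, by omega⟩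
    obtain ⟨e, he⟩ := Int.even_mul_succ_self s
    have hs' : (2 * s + 1) ^ 2 = 4 * (s * (s + 1)) + 1 := by ring
    rw [hs, hs', he]
    omega
  set D : ℤ := -(a : ℤ) with hDdef
  have hΔD : Δ = D * (b : ℤ) ^ 2 := by rw [hΔab, hDdef]; ring
  have hD8 : D % 8 = 5 := by
    have h1 : Δ % 8 = (D % 8) * ((b : ℤ) ^ 2 % 8) % 8 := by rw [hΔD, Int.mul_emod]
    rw [hb8, mul_one, Int.emod_emod_of_dvd _ (dvd_refl _)] at h1
    omega
  have hDneg : D < 0 := by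
    have : (0 : ℤ) < a := by exact_mod_cast ha
    rw [hDdef]; linarith
  have hDfund : (D % 4 = 1 ∧ Squarefree D ∧ D ≠ 1) ∨
      (4 ∣ D ∧ (D / 4 % 4 = 2 ∨ D / 4 % 4 = 3) ∧ Squarefree (D / 4)) := by
    refine Or.inl ⟨by omega, ?_, by omega⟩
    rw [← Int.squarefree_natAbs]
    simpa [hDdef] using hsq
  -- the field
  obtain ⟨k, _, _, hk, hdk⟩ := exists_numberField_discr_eq hDfund
  have hdneg : discr k < 0 := by rw [hdk]; exact hDneg
  haveI : IsTotallyComplex k :=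
    NumberField.nrRealPlaces_eq_zero_iff.mp (nrRealPlaces_eq_zero_and_nrComplexPlaces_eq_one hk hdneg).1
  -- an integral basis `(1, ω)`, `ω² = m + t ω`, `d_k = t² + 4m ≡ 5 (mod 8)`
  obtain ⟨bs, hbs⟩ := exists_basis_zero_eq_one hk
  have hω := basis_one_mul_self_eq bs hbs
  set m : ℤ := bs.repr (bs 1 * bs 1) 0 with hm
  set t : ℤ := bs.repr (bs 1 * bs 1) 1 with ht
  have hd8 : (t ^ 2 + 4 * m) % 8 = 5 := by
    rw [ht, hm, ← discr_eq_sq_add_four_mul bs hbs, hdk]; exact hD8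
  -- no root of `X² - tX - m` mod `2`
  have hno : ∀ x C : ℤ, ((2 : ℕ) : ℤ) * C ≠ x ^ 2 - t * x - m := by
    intro x C h
    apply no_root_two_of_emod_eight hd8 (x : ZMod 2)
    have h' := congrArg (Int.cast : ℤ → ZMod 2) h
    push_cast at h'
    rw [show (2 : ZMod 2) = 0 from rfl, zero_mul] at h'
    push_cast
    linear_combination -h'
  haveI : Algebra.IsQuadraticExtension ℚ k := { finrank_eq_two' := hk }
  refine ⟨k, inferInstance, inferInstance, hk, inferInstance, inferInstance, ⟨(b : ℤ), by rw [hdk, hΔD]⟩,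
    by rw [hdk]; exact hD8, ?_, ?_, fun I => absNorm_ne_two_of_emod_eight bs hbs hω hd8 I⟩
  · -- `δ = b δ_k`
    obtain ⟨-, -, δ₀, -, hδ₀⟩ := exists_sq_eq_discr hk
    refine ⟨(b : ℤ) * δ₀, ?_⟩
    rw [mul_pow, hδ₀, hdk, hΔD]
    push_cast
    ring
  · -- `(2)` is prime: it is the maximal ideal above `2`
    have hne : Ideal.span {((2 : ℕ) : 𝓞 k)} ≠ ⊤ := by
      rw [Ne, Ideal.span_singleton_eq_top]
      intro hu
      have := isUnit_of_isUnit_intCast (K := k) (g := 2) (by exact_mod_cast hu)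
      rcases Int.isUnit_iff.mp this with h | h <;> omega
    obtain ⟨Q, hQmax, hle⟩ := Ideal.exists_le_maximal _ hne
    have h2Q : ((2 : ℕ) : 𝓞 k) ∈ Q := hle (Ideal.mem_span_singleton_self _)
    have hQ := eq_span_natCast_of_inert bs hbs hω Nat.prime_two hno hQmax h2Q
    rw [← hQ]
    exact hQmax.isPrime

end Summit.BirchSwinnertonDyer.BirchSwinnertonDyer.Theorems.HeckeThetaPartner

end
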